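import Literature.Topology.FourManifolds.TopologicalConnectedSumAdditivity
import Literature.Topology.FourManifolds.SmoothIntersectionFormsRealisationFrontier
import Literature.Topology.FourManifolds.SmoothIntersectionFormsRealisationHyperbolic
import Literature.Topology.FourManifolds.LatticeFormsOrthoSumSignature
import Literature.Topology.FourManifolds.LatticeFormsDefinite
import Literature.Topology.FourManifolds.LatticeFormsDiagonal
import Literature.Topology.FourManifolds.LatticeFormsProofs
import Literature.Topology.FourManifolds.LatticeFormsIndefiniteProofs
import Literature.Topology.FourManifolds.LatticeFormsSylvester
import Literature.Topology.FourManifolds.LatticeFormsVanDerBlij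
import HarnessLib

/-!
# Freedman's realisation theorem (`spc4.S05`): topological connected sums shrink the frontier to
# the positive definite forms

Companion of `Literature/Topology/FourManifolds/SmoothIntersectionForms.lean` (statements
unchanged) on the named fact `Literature.Topology.FourManifolds.exists_intersectionForm_equivalent`
(M. H. Freedman, F. Quinn, *Topology of 4-Manifolds* (1990), §10.1 Theorem (1) "Existence",
p. 161). The companion `SmoothIntersectionFormsRealisationFrontier.lean` proved, from the smooth
realisations, the exact frontier
`exists_intersectionForm_equivalent ⇔ (D⁺) ∧ (E⁺)`: (D⁺) every positive definite unimodular form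
that is not diagonalisable over `ℤ` is realised by a closed simply connected topological
4-manifold, (E⁺) every even indefinite unimodular form of positive signature is.

With the TOPOLOGICAL additivity of the intersection form under connected sum, now proved without
any smooth structure (`exists_isTopConnectedSum_intersectionForm_equivalent_prod`,
`TopologicalConnectedSumAdditivity.lean`; Freedman–Quinn 1990, §10.2A: "the form of a connected
sum is the orthogonal sum"), the second family is absorbed by the first:

* §1 `exists_intersectionForm_equivalent_prod_of_realised` — forms realised by closed simply
  connected topological 4-manifolds are closed under orthogonal sum (`‖Q₁‖ # ‖Q₂‖`, topological
  connected sum — the summands, e.g. `‖E₈‖`, need not be smoothable).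
* §2 `exists_realised_hyperbolic_e8_model` — given a realisation of `E₈` (the named fact
  `exists_equivalent_intersectionForm_e8Form`, here a HYPOTHESIS), the model forms
  `(a + 1) H ⊥ c E₈` are realised for all `a, c` (`# (a+1) (S² × S²) # c ‖E₈‖`).
* §3 `exists_intersectionForm_equivalent_of_isEven_of_e8` — hence (E⁺): an even indefinite
  unimodular form of positive signature is isometric to `(a+1) H ⊥ c E₈` (classification of
  indefinite unimodular forms, Serre, Ch. V Thm. 5, the tree's `equivalent_of_isIndefinite_holds`,
  with van der Blij's `8 ∣ σ` and `b⁺ + b⁻ = rank`), so it is realised.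
* §4 **`exists_intersectionForm_equivalent_iff_posDef`** — `E₈` being positive definite,
  unimodular and not diagonalisable over `ℤ` (`not_isDiagonalizable_e8Form`), (D⁺) alone implies
  (E⁺): **Freedman's realisation theorem is equivalent to the realisability of the positive
  definite unimodular forms that are not diagonalisable over `ℤ`** (`E₈`, `E₈ ⊕ ⟨1⟩ⁿ`, `E₈ ⊕ E₈`,
  `D₁₆⁺`, the Niemeier lattices, …; by Donaldson's theorem never by smooth manifolds). This is the
  kernel-checked residue of Freedman–Quinn's proof of 10.1 (p. 168) once `#` is available
  topologically: what remains is exactly the construction of `‖λ‖` for definite `λ` (9.3C / 10.3).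

Everything is proved; no definition and no named fact is introduced.

Sources: M. H. Freedman, F. Quinn, *Topology of 4-Manifolds* (1990), §10.1 Theorem (1) (p. 161),
proof of 10.1 (pp. 167–168), §10.2A (p. 162); M. H. Freedman, J. Diff. Geom. 17 (1982),
Thm. 1.5 and Thm. 1.7; J.-P. Serre, *A Course in Arithmetic* (1973), Ch. V §2.2 Thm. 5;
J. Milnor, D. Husemoller, *Symmetric Bilinear Forms* (1973), II §5 (van der Blij), II Thm. 5.3.
-/

open LinearMap.BilinForm
open Module

noncomputable section

namespace Literature.Topology.FourManifolds

open Literature.AlgebraicTopology.SingularHomology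

/-! ### §1 Realised forms are closed under orthogonal sum -/

/-- **Orthogonal sums of realised forms are realised** (topologically): if `Q₁` and `Q₂` are
intersection forms of closed simply connected topological 4-manifolds, so is `Q₁ ⊥ Q₂` — by the
topological connected sum with its compatible orientation
(`exists_isTopConnectedSum_intersectionForm_equivalent_prod`; Freedman–Quinn 1990, §10.2A).
[cite: FreedmanQuinnPMS1990, §10.2A (p. 162)] -/
theorem exists_intersectionForm_equivalent_prod_of_realised {W₁ W₂ : Type*} [AddCommGroup W₁]
    [AddCommGroup W₂] {B₁ : LinearMap.BilinForm ℤ W₁} {B₂ : LinearMap.BilinForm ℤ W₂}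
    (h₁ : ∃ (M : Type) (_ : TopologicalSpace M) (_ : T2Space M) (_ : SecondCountableTopology M)
      (_ : ChartedSpace (EuclideanSpace ℝ (Fin 4)) M) (_ : CompactSpace M)
      (_ : SimplyConnectedSpace M) (μ : HomologicalOrientation ℤ M 4),
      (intersectionForm two_add_two_eq_four μ).Equivalent B₁)
    (h₂ : ∃ (M : Type) (_ : TopologicalSpace M) (_ : T2Space M) (_ : SecondCountableTopology M)
      (_ : ChartedSpace (EuclideanSpace ℝ (Fin 4)) M) (_ : CompactSpace M)
      (_ : SimplyConnectedSpace M) (μ : HomologicalOrientation ℤ M 4),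
      (intersectionForm two_add_two_eq_four μ).Equivalent B₂) :
    ∃ (M : Type) (_ : TopologicalSpace M) (_ : T2Space M) (_ : SecondCountableTopology M)
      (_ : ChartedSpace (EuclideanSpace ℝ (Fin 4)) M) (_ : CompactSpace M)
      (_ : SimplyConnectedSpace M) (μ : HomologicalOrientation ℤ M 4),
      (intersectionForm two_add_two_eq_four μ).Equivalent (B₁.prod B₂) := by
  obtain ⟨M, _, _, _, _, _, _, μM, hM⟩ := h₁
  obtain ⟨N, _, _, _, _, _, _, μN, hN⟩ := h₂
  obtain ⟨P, _, _, _, _, _, _, μP, -, hP⟩ :=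
    exists_isTopConnectedSum_intersectionForm_equivalent_prod M N μM μN hM hN
  exact ⟨P, inferInstance, inferInstance, inferInstance, inferInstance, inferInstance,
    inferInstance, μP, hP⟩

/-- Realisability is invariant under isometry of forms. [folklore] -/
theorem exists_intersectionForm_equivalent_of_equivalent {W W' : Type*} [AddCommGroup W]
    [Module ℤ W] [AddCommGroup W'] [Module ℤ W'] {B : LinearMap.BilinForm ℤ W}
    {B' : LinearMap.BilinForm ℤ W'} (e : B.Equivalent B')
    (h : ∃ (M : Type) (_ : TopologicalSpace M) (_ : T2Space M) (_ : SecondCountableTopology M)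
      (_ : ChartedSpace (EuclideanSpace ℝ (Fin 4)) M) (_ : CompactSpace M)
      (_ : SimplyConnectedSpace M) (μ : HomologicalOrientation ℤ M 4),
      (intersectionForm two_add_two_eq_four μ).Equivalent B) :
    ∃ (M : Type) (_ : TopologicalSpace M) (_ : T2Space M) (_ : SecondCountableTopology M)
      (_ : ChartedSpace (EuclideanSpace ℝ (Fin 4)) M) (_ : CompactSpace M)
      (_ : SimplyConnectedSpace M) (μ : HomologicalOrientation ℤ M 4),
      (intersectionForm two_add_two_eq_four μ).Equivalent B' := by
  obtain ⟨M, _, _, _, _, _, _, μ, hM⟩ := h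
  exact ⟨M, inferInstance, inferInstance, inferInstance, inferInstance, inferInstance,
    inferInstance, μ, hM.trans e⟩

/-! ### §2 The model forms `(a + 1) H ⊥ c E₈` are realised once `E₈` is -/

/-- Transport of a bilinear form along a linear equivalence is an isometry (Mathlib's
`LinearMap.BilinForm.congr`). [folklore] -/
theorem equivalent_congr {V W : Type*} [AddCommGroup V] [Module ℤ V] [AddCommGroup W]
    [Module ℤ W] (e : V ≃ₗ[ℤ] W) (Q : LinearMap.BilinForm ℤ V) :
    Q.Equivalent (LinearMap.BilinForm.congr e Q) :=
  ⟨{ toLinearEquiv := e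
     map_app' := fun x y => by
       change Q (e.symm (e x)) (e.symm (e y)) = Q x y
       rw [e.symm_apply_apply, e.symm_apply_apply] }⟩

/-- A symmetric form stays symmetric after transport. [folklore] -/
theorem isSymm_congr {V W : Type*} [AddCommGroup V] [Module ℤ V] [AddCommGroup W] [Module ℤ W]
    (e : V ≃ₗ[ℤ] W) {Q : LinearMap.BilinForm ℤ V} (hs : Q.IsSymm) :
    (LinearMap.BilinForm.congr e Q).IsSymm :=
  ⟨fun x y => by
    rw [LinearMap.BilinForm.congr_apply, LinearMap.BilinForm.congr_apply, hs.eq]⟩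

/-- **One more realised summand on `ℤⁿ`**: if `Q` on `ℤⁿ` and `R` on `ℤᵏ` are symmetric,
unimodular, even and realised, so is a form on `ℤⁿ⁺ᵏ` isometric to `Q ⊥ R`, of signature
`σ(Q) + σ(R)` (topological connected sum, §1; additivity of the index, `signature_prod`).
[cite: FreedmanQuinnPMS1990, §10.2A (p. 162)] -/
theorem exists_realised_add_summand {n k : ℕ} {Q : LinearMap.BilinForm ℤ (Fin n → ℤ)}
    {R : LinearMap.BilinForm ℤ (Fin k → ℤ)} (hs : Q.IsSymm) (hu : Q.IsUnimodular) (he : Q.IsEven)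
    (hsR : R.IsSymm) (huR : R.IsUnimodular) (heR : R.IsEven)
    (hQ : ∃ (M : Type) (_ : TopologicalSpace M) (_ : T2Space M) (_ : SecondCountableTopology M)
      (_ : ChartedSpace (EuclideanSpace ℝ (Fin 4)) M) (_ : CompactSpace M)
      (_ : SimplyConnectedSpace M) (μ : HomologicalOrientation ℤ M 4),
      (intersectionForm two_add_two_eq_four μ).Equivalent Q)
    (hR : ∃ (M : Type) (_ : TopologicalSpace M) (_ : T2Space M) (_ : SecondCountableTopology M)
      (_ : ChartedSpace (EuclideanSpace ℝ (Fin 4)) M) (_ : CompactSpace M)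
      (_ : SimplyConnectedSpace M) (μ : HomologicalOrientation ℤ M 4),
      (intersectionForm two_add_two_eq_four μ).Equivalent R) :
    ∃ Q' : LinearMap.BilinForm ℤ (Fin (n + k) → ℤ),
      Q'.IsSymm ∧ Q'.IsUnimodular ∧ Q'.IsEven ∧ Q'.signature = Q.signature + R.signature ∧
      ∃ (M : Type) (_ : TopologicalSpace M) (_ : T2Space M) (_ : SecondCountableTopology M)
        (_ : ChartedSpace (EuclideanSpace ℝ (Fin 4)) M) (_ : CompactSpace M)
        (_ : SimplyConnectedSpace M) (μ : HomologicalOrientation ℤ M 4),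
        (intersectionForm two_add_two_eq_four μ).Equivalent Q' := by
  -- `ℤⁿ × ℤᵏ ≃ ℤⁿ⁺ᵏ`
  let e : ((Fin n → ℤ) × (Fin k → ℤ)) ≃ₗ[ℤ] (Fin (n + k) → ℤ) :=
    (LinearEquiv.sumArrowLequivProdArrow (Fin n) (Fin k) ℤ ℤ).symm ≪≫ₗ
      LinearEquiv.funCongrLeft ℤ ℤ finSumFinEquiv.symm
  have heq := equivalent_congr e (Q.prod R)
  refine ⟨LinearMap.BilinForm.congr e (Q.prod R),
    isSymm_congr _ (hs.prod hsR),
    isUnimodular_of_equivalent heq (isUnimodular_prod_iff.mpr ⟨hu, huR⟩),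
    (isEven_iff_of_equivalent heq).mp (isEven_prod_iff.mpr ⟨he, heR⟩), ?_,
    exists_intersectionForm_equivalent_of_equivalent heq
      (exists_intersectionForm_equivalent_prod_of_realised hQ hR)⟩
  rw [← signature_eq_of_equivalent heq, signature_prod _ _ hs hsR]

/-- **`(a+1) H ⊥ c E₈` is realised for all `a`, `c`, given a realisation of `E₈`.** There is an
even symmetric unimodular form on `ℤⁿ`, `n = 2 (a + 1) + 8 c`, of signature `8 c`, which is the
intersection form of a closed simply connected topological 4-manifold: start from the hyperbolic
plane `H` (signature `0`, realised smoothly by `S² × S²`,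
`exists_intersectionForm_equivalent_of_signature_eq_zero`) and add `H`'s and `E₈`'s by
topological connected sum (`exists_realised_add_summand`). Freedman–Quinn 1990, §10.1 (p. 162):
the manifolds `# a (S² × S²) # c ‖E₈‖`.
[cite: FreedmanQuinnPMS1990, §10.1 (pp. 161–162) and §10.2A (p. 162)] -/
theorem exists_realised_hyperbolic_e8_model (hE8 : exists_equivalent_intersectionForm_e8Form)
    (a c : ℕ) :
    ∃ (n : ℕ) (Q : LinearMap.BilinForm ℤ (Fin n → ℤ)), n = 2 * (a + 1) + 8 * c ∧
      Q.IsSymm ∧ Q.IsUnimodular ∧ Q.IsEven ∧ Q.signature = 8 * c ∧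
      ∃ (M : Type) (_ : TopologicalSpace M) (_ : T2Space M) (_ : SecondCountableTopology M)
        (_ : ChartedSpace (EuclideanSpace ℝ (Fin 4)) M) (_ : CompactSpace M)
        (_ : SimplyConnectedSpace M) (μ : HomologicalOrientation ℤ M 4),
        (intersectionForm two_add_two_eq_four μ).Equivalent Q := by
  -- the hyperbolic plane, realised (signature zero)
  have hH : ∃ (M : Type) (_ : TopologicalSpace M) (_ : T2Space M) (_ : SecondCountableTopology M)
      (_ : ChartedSpace (EuclideanSpace ℝ (Fin 4)) M) (_ : CompactSpace M)
      (_ : SimplyConnectedSpace M) (μ : HomologicalOrientation ℤ M 4),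
      (intersectionForm two_add_two_eq_four μ).Equivalent hyperbolicForm :=
    exists_intersectionForm_equivalent_of_signature_eq_zero hyperbolicForm isSymm_hyperbolicForm
      isUnimodular_hyperbolicForm_holds signature_hyperbolicForm_holds
  induction c with
  | zero =>
    induction a with
    | zero =>
      exact ⟨2, hyperbolicForm, rfl, isSymm_hyperbolicForm, isUnimodular_hyperbolicForm_holds,
        isEven_hyperbolicForm, signature_hyperbolicForm_holds, hH⟩
    | succ a ih =>
      obtain ⟨n, Q, hn, hs, hu, he, hσ, hreal⟩ := ih
      obtain ⟨Q', hs', hu', he', hσ', hreal'⟩ := exists_realised_add_summand hs hu he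
        isSymm_hyperbolicForm isUnimodular_hyperbolicForm_holds isEven_hyperbolicForm hreal hH
      refine ⟨n + 2, Q', by omega, hs', hu', he', ?_, hreal'⟩
      rw [hσ', hσ, signature_hyperbolicForm_holds, add_zero]
  | succ c ih =>
    obtain ⟨n, Q, hn, hs, hu, he, hσ, hreal⟩ := ih
    obtain ⟨Q', hs', hu', he', hσ', hreal'⟩ := exists_realised_add_summand hs hu he
      isSymm_e8Form isUnimodular_e8Form_holds isEven_e8Form hreal hE8
    refine ⟨n + 8, Q', by omega, hs', hu', he', ?_, hreal'⟩
    rw [hσ', hσ, signature_e8Form_holds]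
    push_cast
    ring

/-! ### §3 (E⁺) from a realisation of `E₈` -/

/-- **Even indefinite unimodular forms of positive signature are realised, given `‖E₈‖`.** By van
der Blij `σ = 8c` (`eight_dvd_signature_of_isEven_holds`), by indefiniteness `|σ| < rank`
(`isIndefinite_iff_abs_signature_lt_finrank`) and `rank - σ = 2 b⁻` is even
(`sigPos_add_sigNeg_eq_finrank_holds`), so `rank = 2(a+1) + 8c`; by the classification of
indefinite unimodular forms (Serre, Ch. V Thm. 5; `equivalent_of_isIndefinite_holds`) the form is
isometric to the realised model `(a+1) H ⊥ c E₈` of §2 (Freedman–Quinn 1990, proof of 10.1,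
p. 168, for the even forms; Freedman 1982, Thm. 1.7 for `‖E₈‖`).
[cite: FreedmanQuinnPMS1990, §10.1 Theorem (1) (p. 161) and proof (p. 168)]
[cite: Serre1973, Ch. V §2.2 Thm. 5] -/
theorem exists_intersectionForm_equivalent_of_isEven_of_e8
    (hE8 : exists_equivalent_intersectionForm_e8Form) {V : Type} [AddCommGroup V] [Module ℤ V]
    [Module.Finite ℤ V] [Module.Free ℤ V] (Q : LinearMap.BilinForm ℤ V) (hs : Q.IsSymm)
    (hu : Q.IsUnimodular) (he : Q.IsEven) (hi : Q.IsIndefinite) (hσ : 0 < Q.signature) :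
    ∃ (M : Type) (_ : TopologicalSpace M) (_ : T2Space M) (_ : SecondCountableTopology M)
      (_ : ChartedSpace (EuclideanSpace ℝ (Fin 4)) M) (_ : CompactSpace M)
      (_ : SimplyConnectedSpace M) (μ : HomologicalOrientation ℤ M 4),
      (intersectionForm two_add_two_eq_four μ).Equivalent Q := by
  -- `σ = 8 c`, `c ≥ 1`
  obtain ⟨k, hk⟩ := eight_dvd_signature_of_isEven_holds (Q := Q) hs hu he
  -- `|σ| < rank` and `rank - σ = 2 b⁻` is even
  have hlt := (isIndefinite_iff_abs_signature_lt_finrank hs hu.separatingLeft).mp hi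
  have hpn := sigPos_add_sigNeg_eq_finrank_holds (Q := Q) hu hs
  have hsig : Q.signature = (sigPos Q.toQuadraticMap : ℤ) - (sigNeg Q.toQuadraticMap : ℤ) := rfl
  rw [abs_of_pos hσ] at hlt
  -- the parameters `a`, `c`
  obtain ⟨c, rfl⟩ : ∃ c : ℕ, k = (c : ℤ) := ⟨k.toNat, (Int.toNat_of_nonneg (by omega)).symm⟩
  obtain ⟨a, ha⟩ : ∃ a : ℕ, finrank ℤ V = 2 * (a + 1) + 8 * c :=
    ⟨sigNeg Q.toQuadraticMap - 1, by omega⟩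
  -- the realised model with the same invariants
  obtain ⟨n, Q', hn, hs', hu', he', hσ', hreal⟩ := exists_realised_hyperbolic_e8_model hE8 a c
  have hr' : finrank ℤ (Fin n → ℤ) = 2 * (a + 1) + 8 * c := by rw [finrank_fin_fun, hn]
  have hi' : Q'.IsIndefinite := by
    rw [isIndefinite_iff_abs_signature_lt_finrank hs' hu'.separatingLeft, hσ', hr']
    push_cast
    rw [abs_of_nonneg (by positivity)]
    omega
  have heq : Q.Equivalent Q' :=
    equivalent_of_isIndefinite_holds hs hu hi hs' hu' hi' (ha.trans hr'.symm) (hk.trans hσ'.symm)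
      (iff_of_true he he')
  exact exists_intersectionForm_equivalent_of_equivalent heq.symm hreal

/-- **(D⁺) implies a realisation of `E₈`**: `E₈` is positive definite, unimodular, symmetric and
not diagonalisable over `ℤ` (an even form represents no vector of square `1`;
`not_isDiagonalizable_e8Form`). [cite: FreedmanQuinnPMS1990, §10.1 "‖E₈‖" (pp. 161–162)] -/
theorem exists_equivalent_intersectionForm_e8Form_of_posDef
    (hdef : ∀ {V : Type} [AddCommGroup V] [Module ℤ V] [Module.Finite ℤ V] [Module.Free ℤ V]
      (Q : LinearMap.BilinForm ℤ V), Q.IsSymm → Q.IsUnimodular → Q.PosDef →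
        ¬ Q.IsDiagonalizable →
      ∃ (M : Type) (_ : TopologicalSpace M) (_ : T2Space M) (_ : SecondCountableTopology M)
        (_ : ChartedSpace (EuclideanSpace ℝ (Fin 4)) M) (_ : CompactSpace M)
        (_ : SimplyConnectedSpace M) (μ : HomologicalOrientation ℤ M 4),
        (intersectionForm two_add_two_eq_four μ).Equivalent Q) :
    exists_equivalent_intersectionForm_e8Form :=
  hdef e8Form isSymm_e8Form isUnimodular_e8Form_holds posDef_e8Form_holds
    not_isDiagonalizable_e8Form

/-! ### §4 The frontier is the positive definite family alone -/

/-- **Freedman's realisation theorem reduces to the positive definite non-diagonalisable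
forms.** `exists_intersectionForm_equivalent` (Freedman–Quinn 1990, §10.1 Theorem (1)) holds as
soon as every positive definite symmetric unimodular form that is not diagonalisable over `ℤ` is
the intersection form of a closed simply connected topological 4-manifold: the family (E⁺) of the
frontier theorem `exists_intersectionForm_equivalent_iff_posDef_and_isEven` follows from (D⁺)
through `‖E₈‖` and topological connected sums (§1–§3).
[cite: FreedmanQuinnPMS1990, §10.1 Theorem (1) (p. 161); proof of 10.1 (p. 168)] -/
theorem exists_intersectionForm_equivalent_of_posDef
    (hdef : ∀ {V : Type} [AddCommGroup V] [Module ℤ V] [Module.Finite ℤ V] [Module.Free ℤ V]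
      (Q : LinearMap.BilinForm ℤ V), Q.IsSymm → Q.IsUnimodular → Q.PosDef →
        ¬ Q.IsDiagonalizable →
      ∃ (M : Type) (_ : TopologicalSpace M) (_ : T2Space M) (_ : SecondCountableTopology M)
        (_ : ChartedSpace (EuclideanSpace ℝ (Fin 4)) M) (_ : CompactSpace M)
        (_ : SimplyConnectedSpace M) (μ : HomologicalOrientation ℤ M 4),
        (intersectionForm two_add_two_eq_four μ).Equivalent Q) :
    exists_intersectionForm_equivalent :=
  exists_intersectionForm_equivalent_of_posDef_of_isEven hdef fun Q hs hu he hi hσ =>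
    exists_intersectionForm_equivalent_of_isEven_of_e8
      (exists_equivalent_intersectionForm_e8Form_of_posDef hdef) Q hs hu he hi hσ

/-- **The exact frontier of Freedman's realisation theorem, after topological connected sums:
`exists_intersectionForm_equivalent ⇔ (D⁺)`** — the realisability of the positive definite
symmetric unimodular forms that are not diagonalisable over `ℤ` (Freedman–Quinn 1990, §10.1;
by Donaldson's Theorem 8.4A(1) none of them is the form of a smooth manifold, so this is
precisely the topological core `‖λ‖`, λ definite, of the printed proof: 9.3C / 10.3).
[cite: FreedmanQuinnPMS1990, §10.1 Theorem (1) (p. 161); proof of 10.1 (pp. 167–168)] -/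
theorem exists_intersectionForm_equivalent_iff_posDef :
    exists_intersectionForm_equivalent ↔
      ∀ {V : Type} [AddCommGroup V] [Module ℤ V] [Module.Finite ℤ V] [Module.Free ℤ V]
        (Q : LinearMap.BilinForm ℤ V), Q.IsSymm → Q.IsUnimodular → Q.PosDef →
          ¬ Q.IsDiagonalizable →
        ∃ (M : Type) (_ : TopologicalSpace M) (_ : T2Space M) (_ : SecondCountableTopology M)
          (_ : ChartedSpace (EuclideanSpace ℝ (Fin 4)) M) (_ : CompactSpace M)
          (_ : SimplyConnectedSpace M) (μ : HomologicalOrientation ℤ M 4),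
          (intersectionForm two_add_two_eq_four μ).Equivalent Q :=
  ⟨fun h => fun Q hs hu _ _ => h Q hs hu, exists_intersectionForm_equivalent_of_posDef⟩

/-- **(E⁺) from the `E₈` manifold alone**: the existence of `‖E₈‖` (the named fact
`exists_equivalent_intersectionForm_e8Form`, Freedman 1982 Thm. 1.7) already yields every even
indefinite unimodular form as an intersection form of a closed simply connected topological
4-manifold (both signs of the signature, by orientation reversal; signature zero smoothly).
[cite: FreedmanQuinnPMS1990, §10.1 (pp. 161–162, 168)] -/
theorem exists_intersectionForm_equivalent_of_isEven_of_isIndefinite_of_e8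
    (hE8 : exists_equivalent_intersectionForm_e8Form) {V : Type} [AddCommGroup V] [Module ℤ V]
    [Module.Finite ℤ V] [Module.Free ℤ V] (Q : LinearMap.BilinForm ℤ V) (hs : Q.IsSymm)
    (hu : Q.IsUnimodular) (he : Q.IsEven) (hi : Q.IsIndefinite) :
    ∃ (M : Type) (_ : TopologicalSpace M) (_ : T2Space M) (_ : SecondCountableTopology M)
      (_ : ChartedSpace (EuclideanSpace ℝ (Fin 4)) M) (_ : CompactSpace M)
      (_ : SimplyConnectedSpace M) (μ : HomologicalOrientation ℤ M 4),
      (intersectionForm two_add_two_eq_four μ).Equivalent Q := by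
  rcases lt_trichotomy 0 Q.signature with hσ | hσ | hσ
  · exact exists_intersectionForm_equivalent_of_isEven_of_e8 hE8 Q hs hu he hi hσ
  · exact exists_intersectionForm_equivalent_of_signature_eq_zero Q hs hu hσ.symm
  · refine exists_intersectionForm_equivalent_of_neg Q
      (exists_intersectionForm_equivalent_of_isEven_of_e8 hE8 (-Q) hs.neg
        (isUnimodular_neg_of_isUnimodular hu) ((isEven_neg_iff Q).mpr he)
        ((isIndefinite_neg_iff Q).mpr hi) ?_)
    rw [signature_neg]
    exact neg_pos.mpr hσ

end Literature.Topology.FourManifolds
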